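import Summits.NavierStokesRegularity.NavierStokesRegularity.Theorems.QuantisedSymmetryLiouvilleKillsProfile
import Literature.Analysis.FluidPDE.SelfSimilar
import Mathlib.Analysis.SpecificLimits.Basic
import HarnessLib

/-!
# Crux `PolyhedralDssProfileExists` (stmt-NavierStokesRegularity-1404), line `polyhedral_cell` —
# stub N3 `stub_singularOrigin` (the space–time origin of a nontrivial DSS field is singular)

Let `V : ℝ → ℝ³ → ℝ³` be exactly `c`-DSS (`nsRescale c V = V`, `1 < c`) and nonzero at one point
`(t₀, x₀)` of the past. Then `V` is unbounded in every parabolic cylinder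
`Q_r = (-r², 0) × B_r(0)`, `r > 0`.

Proof. Iterating the group law of the parabolic rescaling gives `nsRescale (c ^ k) V = V` for every
`k : ℕ` (tree lemma `quantisedSymmetry_isDiscretelySelfSimilar_pow`); read at the zoomed point this
is `V (t₀ / (cᵏ)², (cᵏ)⁻¹ • x₀) = cᵏ • V (t₀, x₀)` (`dss_zoom_value`). As `k → ∞`,
`t₀ / (cᵏ)² → 0⁻`, `‖(cᵏ)⁻¹ • x₀‖ = (cᵏ)⁻¹ ‖x₀‖ → 0` and `cᵏ ‖V (t₀, x₀)‖ → ∞`, so for `k` large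
the zoomed point lies in `Q_r` and carries a value of norm `> M`. Pure scaling algebra
(Leray 1934, (3.11)); no PDE is used.
-/

noncomputable section

-- the summit namespace `…NavierStokesRegularity.NavierStokesRegularity…` is the tree convention (D-0017)
set_option linter.dupNamespace false

namespace Summit.NavierStokesRegularity.NavierStokesRegularity.Theorems.PolyhedralDssProfileExists.PolyhedralCell

open MeasureTheory Set Function Filter Topology
open Literature.Analysis Literature.Analysis.FluidPDE

/-- **The values of a DSS field at zoomed points.** If `nsRescale d V = V` with `d ≠ 0`, then
`V (t₀ / d², d⁻¹ • x₀) = d • V (t₀, x₀)`: the self-similarity `d • V (d² s, d • y) = V (s, y)`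
(Leray 1934, (3.11)) read at `s = t₀ / d²`, `y = d⁻¹ • x₀`. [cite: Leray1934, (3.11)] -/
theorem dss_zoom_value {E F : Type*} [NormedAddCommGroup E] [NormedSpace ℝ E]
    [NormedAddCommGroup F] [NormedSpace ℝ F] {d : ℝ} (hd : d ≠ 0) {V : ℝ → E → F}
    (hdss : IsDiscretelySelfSimilar d V) (t₀ : ℝ) (x₀ : E) :
    V (t₀ / d ^ 2) (d⁻¹ • x₀) = d • V t₀ x₀ := by
  have hd2 : (d ^ 2 : ℝ) ≠ 0 := pow_ne_zero 2 hd
  have key := congrFun (congrFun hdss (t₀ / d ^ 2)) (d⁻¹ • x₀)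
  rw [nsRescale_apply, mul_div_cancel₀ _ hd2, smul_inv_smul₀ hd] at key
  exact key.symm

/-- **Stub N3: the origin is a genuine singular point.** A field `V` which is exactly `c`-DSS
(`c > 1`) and nonzero at one point `(t₀, x₀)` of the past is unbounded in every parabolic cylinder
`Q_r = (-r², 0) × B_r(0)`: the zoom images `(t₀ / (cᵏ)², (cᵏ)⁻¹ • x₀)`, `k → ∞`, enter `Q_r`
(`t₀ / (cᵏ)² → 0⁻`, `(cᵏ)⁻¹ ‖x₀‖ → 0`) and carry the values
`‖V (t₀ / (cᵏ)², (cᵏ)⁻¹ • x₀)‖ = cᵏ ‖V (t₀, x₀)‖ → ∞` (`dss_zoom_value` with `d = c ^ k`,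
`quantisedSymmetry_isDiscretelySelfSimilar_pow`). For a witness of the crux this says that no
modification on null sets makes the profile locally bounded at the space–time origin.
[cite: Leray1934, (3.11)] -/
theorem stub_singularOrigin :
    ∀ (c : ℝ) (V : ℝ → EuclideanSpace ℝ (Fin 3) → EuclideanSpace ℝ (Fin 3)), 1 < c →
      IsDiscretelySelfSimilar c V → (∃ t₀ < 0, ∃ x₀, V t₀ x₀ ≠ 0) →
      ∀ r : ℝ, 0 < r → ∀ M : ℝ, ∃ t ∈ Set.Ioo (-r ^ 2) 0, ∃ x : EuclideanSpace ℝ (Fin 3),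
        ‖x‖ < r ∧ M < ‖V t x‖ := by
  intro c V hc hdss hnz r hr M
  obtain ⟨t₀, ht₀, x₀, hx₀⟩ := hnz
  have hc0 : 0 < c := one_pos.trans hc
  have hnorm : 0 < ‖V t₀ x₀‖ := norm_pos_iff.2 hx₀
  -- the three limits along the zoom sequence `k ↦ c ^ k`
  have hpow : Tendsto (fun k : ℕ => c ^ k) atTop atTop := tendsto_pow_atTop_atTop_of_one_lt hc
  have hsq : Tendsto (fun k : ℕ => (c ^ k) ^ 2) atTop atTop :=
    (tendsto_pow_atTop two_ne_zero).comp hpow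
  have htime : Tendsto (fun k : ℕ => t₀ / (c ^ k) ^ 2) atTop (𝓝 0) :=
    tendsto_const_nhds.div_atTop hsq
  have hinv : Tendsto (fun k : ℕ => (c ^ k)⁻¹ * ‖x₀‖) atTop (𝓝 0) := by
    have h := (tendsto_inv_atTop_zero.comp hpow).mul_const ‖x₀‖
    rw [zero_mul] at h
    exact h
  have hval : Tendsto (fun k : ℕ => c ^ k * ‖V t₀ x₀‖) atTop atTop :=
    hpow.atTop_mul_const hnorm
  -- pick `k` large enough for all three requirements
  have hr2 : -r ^ 2 < (0 : ℝ) := neg_neg_of_pos (pow_pos hr 2)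
  have hev : ∀ᶠ k : ℕ in atTop,
      -r ^ 2 < t₀ / (c ^ k) ^ 2 ∧ ((c ^ k)⁻¹ * ‖x₀‖ < r ∧ M < c ^ k * ‖V t₀ x₀‖) :=
    (htime.eventually_const_lt hr2).and
      ((hinv.eventually_lt_const hr).and (hval.eventually_gt_atTop M))
  obtain ⟨k, hk₁, hk₂, hk₃⟩ := hev.exists
  have hck : (0 : ℝ) < c ^ k := pow_pos hc0 k
  refine ⟨t₀ / (c ^ k) ^ 2, ⟨hk₁, div_neg_of_neg_of_pos ht₀ (pow_pos hck 2)⟩, (c ^ k)⁻¹ • x₀,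
    ?_, ?_⟩
  · rwa [norm_smul, Real.norm_of_nonneg (inv_nonneg.2 hck.le)]
  · rw [dss_zoom_value hck.ne' (quantisedSymmetry_isDiscretelySelfSimilar_pow hdss k) t₀ x₀,
      norm_smul, Real.norm_of_nonneg hck.le]
    exact hk₃

end Summit.NavierStokesRegularity.NavierStokesRegularity.Theorems.PolyhedralDssProfileExists.PolyhedralCell
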